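import Literature.Geometry.Riemannian.KernelNashEntropySuperharmonicAux
import Literature.Geometry.Riemannian.KernelFisherInformationBound
import Literature.Geometry.Riemannian.HeatKernelVeryWeak
import Mathlib.Analysis.SpecialFunctions.Integrals.Basic
import HarnessLib

/-!
# The pointed Nash entropy of the conjugate heat kernel is dominated by its heat-kernel average:
# the `□𝒩* ≤ 0` half of Bamler 2020a, (5.15)

R. Bamler, *Entropy and heat kernel bounds on a Ricci flow background*, arXiv:2008.07093 (2020a),
§5: for the conjugate heat kernels `K` of a Ricci flow on a closed `m`-manifold and `s < t`, the
pointed Nash entropy `𝒩*_s(x, t) = 𝒩_{x,t}(t − s)` satisfies `□𝒩*_s ≤ 0` as a function of the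
base point (Thm. 5.9, from `□_{(z,σ)} 𝒩*_s = −∫ |∇_z K|²/K dg_s + m/(2(σ − s))` and the
Fisher-information bound of Prop. 4.2), whence the first inequality of (5.15),

  `𝒩*_s(x, t) ≤ ∫ 𝒩*_s(z, σ) dν_{x,t;σ}(z)`     (`s < σ < t`).

This file PROVES that inequality for a Ricci flow `hflow = (h, cov)` on `[a, T]` of a `C^∞`
family of Riemannian metrics on a closed connected manifold `M` modelled on `ℝᵐ`, with the
tree's kernel `K = hflow.heatKernelFn hh hR` and measures
`ν_{x,t;σ} = heatKernelMeasure hh hR t x σ`, for `a < s < σ < t < T`, WITHOUT differentiating `𝒩*`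
twice in the base point: with `Λ(u) = −u log u`,
`𝒩*_s(z, σ) = ∫ Λ(K(z,σ;y,s)) dg_s(y) − (m/2) log(4π(σ − s)) − m/2`, and for each FIXED `y` the
function `Λ(K(z,σ;y,s))` is a smooth super-solution of the heat equation in `(z, σ)` with
`(∂_σ − Δ_z) Λ(K) = |∇_z K|²/K`; paired with the conjugate heat solution `K(x,t;·,·)` this gives,
for `s < σ₁ < σ₂ < t`,
`∫ Λ(K(·,σ₂;y,s)) dν_{σ₂} − ∫ Λ(K(·,σ₁;y,s)) dν_{σ₁} = ∫_{σ₁}^{σ₂} ∫ |∇_z K|²/K dν_σ dσ`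
(`KernelNashEntropySuperharmonicAux.lean`). Integrating in `y` (Fubini; the integrand is jointly
continuous by `continuousOn_gradSq_heatKernelFn_basePoint`) and using
`∫ |∇_z K|²/K dg_s(y) = ∫ |∇_z K|²/K² dν_{z,σ;s} ≤ m/(2(σ − s))`
(`mul_integral_gradSq_heatKernelFn_div_sq_le`, Prop. 4.2) shows that
`σ ↦ ∫ 𝒩*_s(·, σ) dν_{x,t;σ}` is non-increasing on `(s, t)`; it tends to `𝒩*_s(x, t)` as
`σ → t⁻` (`ν_{x,t;t} = δ_x`, `continuous_integral_slice_heatKernelMeasure`).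

* `integral_gradSq_div_heatKernelFn_le` — `∫ |∇_z K|²/K dg_s ≤ (m/2)(σ − s)⁻¹`;
* `integral_integral_negMulLog_heatKernelFn_sub_le` — the `y`-integrated pairing identity,
  bounded by `(m/2)(log(σ₂ − s) − log(σ₁ − s))`;
* `integral_kernelNashEntropy_heatKernelMeasure_anti` — monotonicity of the averaged entropy;
* `kernelNashEntropy_le_integral_kernelNashEntropy_heatKernelMeasure` — **(5.15), first
  inequality**.

All in the self-model `𝓘(ℝ, ℝᵐ)` of the Fisher-information bound. Everything is proved; no
definitions, no named facts. What is NOT here: the pointwise evolution inequality `□𝒩*_s ≤ 0`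
itself (second base-point derivatives of `𝒩*`), the Jensen half of (5.15)
(`KernelNashEntropyJensen.lean`), and the oscillation bound Cor. 5.10.

## References

* R. H. Bamler, *Entropy and heat kernel bounds on a Ricci flow background*, arXiv:2008.07093
  (2020), §4.1 Prop. 4.2, §5 Thm. 5.9, §5.4 (5.15). [Bamler2020Entropy]
-/

noncomputable section

open Bundle Set Function Filter Manifold MeasureTheory Measure TopologicalSpace
open scoped Manifold ContDiff Topology ENNReal NNReal

namespace Literature.Geometry.Riemannian

open Lorentzian Lorentzian.PseudoRiemannianMetric

/-- `log(4π(σ − s)) = log(4π) + log(σ − s)` for `s < σ`. [folklore] -/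
private theorem log_four_pi_mul_sub {s σ : ℝ} (hsσ : s < σ) :
    Real.log (4 * Real.pi * (σ - s)) = Real.log (4 * Real.pi) + Real.log (σ - s) :=
  Real.log_mul (by positivity) (sub_pos.2 hsσ).ne'

/-! ### The Fisher-information bound and the monotonicity of the averaged entropy -/

section SelfModel

variable {m : ℕ} {M : Type*} [TopologicalSpace M] [ChartedSpace (EuclideanSpace ℝ (Fin m)) M]
  [IsManifold 𝓘(ℝ, EuclideanSpace ℝ (Fin m)) ∞ M] [T2Space M] [CompactSpace M]
  [SecondCountableTopology M] [MeasurableSpace M] [BorelSpace M] [ConnectedSpace M]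
  {h : ℝ → PseudoRiemannianMetric 𝓘(ℝ, EuclideanSpace ℝ (Fin m)) ∞ (EuclideanSpace ℝ (Fin m))
    (TangentSpace 𝓘(ℝ, EuclideanSpace ℝ (Fin m)) : M → Type _)}
  {cov : ℝ → CovariantDerivative 𝓘(ℝ, EuclideanSpace ℝ (Fin m)) (EuclideanSpace ℝ (Fin m))
    (TangentSpace 𝓘(ℝ, EuclideanSpace ℝ (Fin m)) : M → Type _)}
  {a T : ℝ} (hflow : IsRicciFlow h cov (Icc a T)) (hh : IsContMDiffFamilyOn ∞ h univ)
  (hR : ∀ r, (h r).IsRiemannian)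

/-- **`∫ |∇_z K|²/K dg_s ≤ (m/2)(σ − s)⁻¹`** for `a < s < σ < T`: with
`dν_{z,σ;s} = K(z,σ;·,s) dg_s`,
`∫ |∇_z K(z,σ;y,s)|²/K dg_s(y) = ∫ |∇_z K|²/K² dν_{z,σ;s} ≤ m/(2(σ − s))` by Bamler's Prop. 4.2
(`mul_integral_gradSq_heatKernelFn_div_sq_le`). [cite: Bamler2020Entropy, §4.1, Prop. 4.2] -/
theorem integral_gradSq_div_heatKernelFn_le {s σ : ℝ} (has : a < s) (hsσ : s < σ) (hσT : σ < T)
    (z : M) :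
    ∫ y, (h σ).gradSq (fun z' ↦ hflow.heatKernelFn hh hR σ z' (y, s)) z /
        hflow.heatKernelFn hh hR σ z (y, s) ∂(h s).riemVolume ≤ (m : ℝ) / 2 * (σ - s)⁻¹ := by
  have hσ' : σ ∈ Ioc a T := ⟨has.trans hsσ, hσT.le⟩
  have hs' : s ∈ Ioo a σ := ⟨has, hsσ⟩
  have hF := mul_integral_gradSq_heatKernelFn_div_sq_le hflow hh hR has hsσ hσT z
  rw [hflow.integral_heatKernelMeasure_eq_integral_mul_heatKernelFn hh hR hσ' z hs'] at hF
  have heq : ∫ y, (h σ).gradSq (fun z' ↦ hflow.heatKernelFn hh hR σ z' (y, s)) z /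
        hflow.heatKernelFn hh hR σ z (y, s) ∂(h s).riemVolume =
      ∫ y, (h σ).gradSq (fun z' ↦ hflow.heatKernelFn hh hR σ z' (y, s)) z /
        hflow.heatKernelFn hh hR σ z (y, s) ^ 2 * hflow.heatKernelFn hh hR σ z (y, s)
          ∂(h s).riemVolume := by
    refine integral_congr_ae (Eventually.of_forall fun y ↦ ?_)
    have hk : hflow.heatKernelFn hh hR σ z (y, s) ≠ 0 :=
      (hflow.heatKernelFn_pos hh hR hσ' z ⟨mem_univ _, hs'⟩).ne'
    field_simp
  rw [heq, le_mul_inv_iff₀ (sub_pos.2 hsσ), mul_comm]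
  exact hF

/-- **The `y`-integrated pairing identity, bounded by the Fisher information** (the analytic
core of `□𝒩*_s ≤ 0`, Bamler 2020a, Thm. 5.9, in integrated form): for `a < s < σ₁ < σ₂ < t ≤ T`,
`∫∫ Λ(K(z,σ₂;y,s)) dν_{x,t;σ₂}(z) dg_s(y) − ∫∫ Λ(K(z,σ₁;y,s)) dν_{x,t;σ₁}(z) dg_s(y)
  ≤ (m/2)(log(σ₂ − s) − log(σ₁ − s))`.
Proof: integrate `IsRicciFlow.integral_negMulLog_heatKernelFn_sub_eq` over `y` and swap the
`y`- and `σ`-integrals (Fubini on `M × [σ₁, σ₂]`; the integrand `∫ |∇_z K|²/K dν_σ(z)` is continuous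
in `σ` and in `y` separately and bounded, by the joint continuity
`continuousOn_gradSq_div_heatKernelFn_basePoint` on the compact slab), swap once more on `M × M`
and bound `∫ |∇_z K|²/K dg_s(y) ≤ (m/2)(σ − s)⁻¹` (`integral_gradSq_div_heatKernelFn_le`);
finally `∫_{σ₁}^{σ₂} (σ − s)⁻¹ dσ = log((σ₂ − s)/(σ₁ − s))`.
[cite: Bamler2020Entropy, §5, proof of Thm. 5.9 / (5.15)] -/
theorem integral_integral_negMulLog_heatKernelFn_sub_le {s σ₁ σ₂ t : ℝ} (has : a < s)
    (hs₁ : s < σ₁) (h12 : σ₁ < σ₂) (hσ₂t : σ₂ < t) (htT : t ≤ T) (x : M) :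
    ∫ y, ∫ z, Real.negMulLog (hflow.heatKernelFn hh hR σ₂ z (y, s))
          ∂(heatKernelMeasure hh hR t x σ₂) ∂(h s).riemVolume -
        ∫ y, ∫ z, Real.negMulLog (hflow.heatKernelFn hh hR σ₁ z (y, s))
          ∂(heatKernelMeasure hh hR t x σ₁) ∂(h s).riemVolume ≤
      (m : ℝ) / 2 * (Real.log (σ₂ - s) - Real.log (σ₁ - s)) := by
  have ht : t ∈ Ioc a T := ⟨((has.trans hs₁).trans h12).trans hσ₂t, htT⟩
  have hsT : s ∈ Ioo a T := ⟨has, ((hs₁.trans h12).trans hσ₂t).trans_le htT⟩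
  have hsub : Icc σ₁ σ₂ ⊆ Ioo s T := fun r hr ↦
    ⟨hs₁.trans_le hr.1, (hr.2.trans_lt hσ₂t).trans_le htT⟩
  haveI : IsFiniteMeasure (h s).riemVolume := ⟨(h s).riemVolume_univ_lt_top⟩
  -- the integrand `G σ z y = |∇_z K(z,σ;y,s)|² / K(z,σ;y,s)` and the clamp to `[σ₁, σ₂]`
  let G : ℝ → M → M → ℝ := fun σ z y ↦
    (h σ).gradSq (fun z' ↦ hflow.heatKernelFn hh hR σ z' (y, s)) z /
      hflow.heatKernelFn hh hR σ z (y, s)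
  have hG : G = fun σ z y ↦ (h σ).gradSq (fun z' ↦ hflow.heatKernelFn hh hR σ z' (y, s)) z /
      hflow.heatKernelFn hh hR σ z (y, s) := rfl
  let cl : ℝ → ℝ := fun σ ↦ max σ₁ (min σ σ₂)
  have hclmem : ∀ σ, cl σ ∈ Icc σ₁ σ₂ := fun σ ↦
    ⟨le_max_left _ _, max_le h12.le (min_le_right _ _)⟩
  have hcleq : ∀ σ ∈ Icc σ₁ σ₂, cl σ = σ := fun σ hσ ↦ by
    show max σ₁ (min σ σ₂) = σ
    rw [min_eq_left hσ.2, max_eq_right hσ.1]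
  have hclc : Continuous cl := continuous_const.max (continuous_id.min continuous_const)
  -- joint continuity and a bound of the clamped integrand
  have hGc : Continuous fun q : (M × ℝ) × M ↦ G (cl q.1.2) q.1.1 q.2 := by
    have hι : Continuous fun q : (M × ℝ) × M ↦ (((q.1.1, cl q.1.2) : M × ℝ), q.2) :=
      ((continuous_fst.comp continuous_fst).prodMk
        (hclc.comp (continuous_snd.comp continuous_fst))).prodMk continuous_snd
    have h0 := (continuousOn_gradSq_div_heatKernelFn_basePoint hflow hh hR hsT).comp_continuous
      hι fun q ↦ ⟨⟨mem_univ _, hsub (hclmem _)⟩, mem_univ _⟩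
    exact h0
  obtain ⟨G₀, hG₀⟩ : ∃ G₀ : ℝ, ∀ σ z y, |G (cl σ) z y| ≤ G₀ := by
    obtain ⟨C, hC⟩ := ((isCompact_univ.prod (isCompact_Icc (a := σ₁) (b := σ₂))).prod
      isCompact_univ).exists_bound_of_continuousOn (f := fun q : (M × ℝ) × M ↦
        G (cl q.1.2) q.1.1 q.2) hGc.continuousOn
    refine ⟨C, fun σ z y ↦ ?_⟩
    have h1 := hC ((z, cl σ), y) ⟨⟨mem_univ _, hclmem σ⟩, mem_univ _⟩
    simp only [Real.norm_eq_abs, hcleq _ (hclmem σ)] at h1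
    exact h1
  -- `B σ y = ∫ G (cl σ) z y dν_{x,t;σ}(z)`: continuous in `σ`, continuous in `y`, bounded
  let B : ℝ → M → ℝ := fun σ y ↦ ∫ z, G (cl σ) z y ∂(heatKernelMeasure hh hR t x σ)
  have hB : B = fun σ y ↦ ∫ z, G (cl σ) z y ∂(heatKernelMeasure hh hR t x σ) := rfl
  have hBσ : ∀ y, Continuous fun σ ↦ B σ y := by
    intro y
    have hι : Continuous fun p : M × ℝ ↦ ((p, y) : (M × ℝ) × M) :=
      continuous_id.prodMk continuous_const
    have h3 := hGc.comp hι
    have hΦy : Continuous fun p : M × ℝ ↦ G (cl p.2) p.1 y := h3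
    have h4 := continuous_integral_slice_heatKernelMeasure hh hR hΦy t x
    exact h4
  have hGσ : ∀ σ, Continuous (uncurry fun y z ↦ G (cl σ) z y) := by
    intro σ
    have hι : Continuous fun p : M × M ↦ (((p.2, σ) : M × ℝ), p.1) :=
      (continuous_snd.prodMk continuous_const).prodMk continuous_fst
    have h3 := hGc.comp hι
    exact h3
  have hBy : ∀ σ, Continuous fun y ↦ B σ y := fun σ ↦ by
    have h1 := continuous_parametric_integral_of_continuous
      (μ := heatKernelMeasure hh hR t x σ) (hGσ σ) isCompact_univ
    simpa only [Measure.restrict_univ] using h1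
  have hBm : Measurable (uncurry B) :=
    measurable_uncurry_of_continuous_of_measurable hBσ fun σ ↦ (hBy σ).measurable
  have hBbd : ∀ σ y, |B σ y| ≤ G₀ := fun σ y ↦
    abs_integral_heatKernelMeasure_le hh hR t x σ fun z ↦ hG₀ σ z y
  have hBi : Integrable (uncurry fun y σ ↦ B σ y)
      ((h s).riemVolume.prod (volume.restrict (Ioc σ₁ σ₂))) := by
    have hm : AEStronglyMeasurable (uncurry fun y σ ↦ B σ y)
        ((h s).riemVolume.prod (volume.restrict (Ioc σ₁ σ₂))) :=
      (hBm.comp measurable_swap).aestronglyMeasurable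
    refine Integrable.of_bound hm G₀ (ae_of_all _ fun p ↦ ?_)
    rw [Real.norm_eq_abs]
    exact hBbd _ _
  -- the paired identity for every `y`, integrated over `y`: Fubini on `M × [σ₁, σ₂]`
  have hId : ∀ y, ∫ z, Real.negMulLog (hflow.heatKernelFn hh hR σ₂ z (y, s))
        ∂(heatKernelMeasure hh hR t x σ₂) -
      ∫ z, Real.negMulLog (hflow.heatKernelFn hh hR σ₁ z (y, s))
        ∂(heatKernelMeasure hh hR t x σ₁) = ∫ σ in Ioc σ₁ σ₂, B σ y := by
    intro y
    rw [hflow.integral_negMulLog_heatKernelFn_sub_eq hh hR ht x has hs₁ h12 hσ₂t y,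
      intervalIntegral.integral_of_le h12.le]
    refine integral_congr_ae ((ae_restrict_mem measurableSet_Ioc).mono fun σ hσ ↦ ?_)
    simp only [hB, hG, hcleq σ (Ioc_subset_Icc_self hσ)]
  have hT : ∀ {σ}, σ ∈ Icc σ₁ σ₂ → Integrable (fun y ↦ ∫ z,
      Real.negMulLog (hflow.heatKernelFn hh hR σ z (y, s)) ∂(heatKernelMeasure hh hR t x σ))
      (h s).riemVolume := fun hσ ↦
    (hflow.integrable_negMulLog_heatKernelFn_prod hh hR (heatKernelMeasure hh hR t x _) has
      (hs₁.trans_le hσ.1) (hsub hσ).2.le).integral_prod_right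
  have h1 : ∫ y, ∫ z, Real.negMulLog (hflow.heatKernelFn hh hR σ₂ z (y, s))
          ∂(heatKernelMeasure hh hR t x σ₂) ∂(h s).riemVolume -
        ∫ y, ∫ z, Real.negMulLog (hflow.heatKernelFn hh hR σ₁ z (y, s))
          ∂(heatKernelMeasure hh hR t x σ₁) ∂(h s).riemVolume =
      ∫ σ in Ioc σ₁ σ₂, ∫ y, B σ y ∂(h s).riemVolume := by
    rw [← integral_sub (hT (right_mem_Icc.2 h12.le)) (hT (left_mem_Icc.2 h12.le)),
      integral_congr_ae (Eventually.of_forall hId)]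
    have h5 := integral_integral_swap hBi
    exact h5
  -- the Fisher-information bound at every `σ ∈ [σ₁, σ₂]`, after Fubini on `M × M`
  have h2 : ∀ σ ∈ Icc σ₁ σ₂, ∫ y, B σ y ∂(h s).riemVolume ≤ (m : ℝ) / 2 * (σ - s)⁻¹ := by
    intro σ hσ
    have hGi : Integrable (uncurry fun y z ↦ G (cl σ) z y)
        ((h s).riemVolume.prod (heatKernelMeasure hh hR t x σ)) :=
      (hGσ σ).integrable_of_hasCompactSupport (HasCompactSupport.of_compactSpace _)
    have e1 := integral_integral_swap hGi
    have hzi : Integrable (fun z ↦ ∫ y, G (cl σ) z y ∂(h s).riemVolume)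
        (heatKernelMeasure hh hR t x σ) := hGi.integral_prod_right
    have h6 : ∫ z, ∫ y, G (cl σ) z y ∂(h s).riemVolume ∂(heatKernelMeasure hh hR t x σ) ≤
        ∫ _z, (m : ℝ) / 2 * (σ - s)⁻¹ ∂(heatKernelMeasure hh hR t x σ) := by
      refine integral_mono hzi (integrable_const _) fun z ↦ ?_
      have h7 := integral_gradSq_div_heatKernelFn_le hflow hh hR has (hs₁.trans_le hσ.1)
        (hsub hσ).2 z
      simp only [hG, hcleq σ hσ]
      exact h7
    rw [integral_const, smul_eq_mul, probReal_univ, one_mul] at h6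
    exact e1.trans_le h6
  -- integrate the bound over `[σ₁, σ₂]`
  have h3 : ∫ σ in Ioc σ₁ σ₂, ∫ y, B σ y ∂(h s).riemVolume ≤
      ∫ σ in Ioc σ₁ σ₂, (m : ℝ) / 2 * (σ - s)⁻¹ := by
    have hi₁ : Integrable (fun σ ↦ ∫ y, B σ y ∂(h s).riemVolume)
        (volume.restrict (Ioc σ₁ σ₂)) := hBi.integral_prod_right
    have hi₂ : ContinuousOn (fun σ ↦ (m : ℝ) / 2 * (σ - s)⁻¹) (Icc σ₁ σ₂) :=
      continuousOn_const.mul ((continuousOn_id.sub continuousOn_const).inv₀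
        fun σ hσ ↦ (sub_pos.2 (hs₁.trans_le hσ.1)).ne')
    exact setIntegral_mono_on hi₁ (hi₂.integrableOn_Icc.mono_set Ioc_subset_Icc_self)
      measurableSet_Ioc fun σ hσ ↦ h2 σ (Ioc_subset_Icc_self hσ)
  have h4 : ∫ σ in Ioc σ₁ σ₂, (m : ℝ) / 2 * (σ - s)⁻¹ =
      (m : ℝ) / 2 * (Real.log (σ₂ - s) - Real.log (σ₁ - s)) := by
    have e := intervalIntegral.integral_comp_sub_right (fun u : ℝ ↦ u⁻¹) s (a := σ₁) (b := σ₂)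
    rw [← intervalIntegral.integral_of_le h12.le, intervalIntegral.integral_const_mul, e,
      integral_inv_of_pos (sub_pos.2 hs₁) (sub_pos.2 (hs₁.trans h12)),
      Real.log_div (sub_pos.2 (hs₁.trans h12)).ne' (sub_pos.2 hs₁).ne']
  rw [h1, ← h4]
  exact h3

/-- **The averaged pointed Nash entropy is non-increasing in the evaluation time** (the content
of `□𝒩*_s ≤ 0`, Bamler 2020a, Thm. 5.9, in integrated form): for `a < s < σ₁ < σ₂ < t ≤ T`,
`∫ 𝒩*_s(z, σ₂) dν_{x,t;σ₂}(z) ≤ ∫ 𝒩*_s(z, σ₁) dν_{x,t;σ₁}(z)`: write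
`∫ 𝒩*_s(z, σ) dν_σ(z) = ∫∫ Λ(K(z,σ;y,s)) dν_σ(z) dg_s(y) − (m/2) log(4π(σ − s)) − m/2` (Fubini on
`M × M`) and use `integral_integral_negMulLog_heatKernelFn_sub_le`.
[cite: Bamler2020Entropy, §5.4, (5.15)] -/
theorem integral_kernelNashEntropy_heatKernelMeasure_anti {s σ₁ σ₂ t : ℝ} (has : a < s)
    (hs₁ : s < σ₁) (h12 : σ₁ < σ₂) (hσ₂t : σ₂ < t) (htT : t ≤ T) (x : M) :
    ∫ z, pointedNashEntropy h (fun r y ↦ hflow.heatKernelFn hh hR σ₂ z (y, r)) m σ₂ s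
        ∂(heatKernelMeasure hh hR t x σ₂) ≤
      ∫ z, pointedNashEntropy h (fun r y ↦ hflow.heatKernelFn hh hR σ₁ z (y, r)) m σ₁ s
        ∂(heatKernelMeasure hh hR t x σ₁) := by
  have hσT : ∀ {σ}, σ ∈ Icc σ₁ σ₂ → σ ∈ Ioc a T := fun hσ ↦
    ⟨(has.trans hs₁).trans_le hσ.1, ((hσ.2.trans_lt hσ₂t).trans_le htT).le⟩
  haveI : IsFiniteMeasure (h s).riemVolume := ⟨(h s).riemVolume_univ_lt_top⟩
  -- `∫ 𝒩*_s(z, σ) dν_σ = ∫∫ Λ(K(z,σ;y,s)) dν_σ(z) dg_s(y) − c σ`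
  have hΨ : ∀ {σ}, σ ∈ Icc σ₁ σ₂ →
      ∫ z, pointedNashEntropy h (fun r y ↦ hflow.heatKernelFn hh hR σ z (y, r)) m σ s
          ∂(heatKernelMeasure hh hR t x σ) =
        ∫ y, ∫ z, Real.negMulLog (hflow.heatKernelFn hh hR σ z (y, s))
          ∂(heatKernelMeasure hh hR t x σ) ∂(h s).riemVolume -
          ((m : ℝ) / 2 * Real.log (4 * Real.pi * (σ - s)) + (m : ℝ) / 2) := by
    intro σ hσ
    have hΛi := hflow.integrable_negMulLog_heatKernelFn_prod hh hR
      (heatKernelMeasure hh hR t x σ) has (hs₁.trans_le hσ.1) (hσT hσ).2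
    have hSi : Integrable (fun z ↦ ∫ y, Real.negMulLog (hflow.heatKernelFn hh hR σ z (y, s))
        ∂(h s).riemVolume) (heatKernelMeasure hh hR t x σ) := hΛi.integral_prod_left
    simp_rw [hflow.kernelNashEntropy_eq_integral_negMulLog_sub hh hR (hσT hσ) _
      ⟨has, hs₁.trans_le hσ.1⟩]
    rw [integral_sub hSi (integrable_const _), integral_const, smul_eq_mul, probReal_univ,
      one_mul, integral_integral_swap hΛi]
  rw [hΨ (right_mem_Icc.2 h12.le), hΨ (left_mem_Icc.2 h12.le),
    log_four_pi_mul_sub hs₁, log_four_pi_mul_sub (hs₁.trans h12)]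
  have h1 := integral_integral_negMulLog_heatKernelFn_sub_le hflow hh hR has hs₁ h12 hσ₂t htT x
  linarith

/-- **Bamler 2020a, (5.15), first inequality** (`□𝒩* ≤ 0` half of Thm. 5.9, integrated against
the conjugate heat kernel): for a Ricci flow `(h, cov)` on `[a, T]` of a `C^∞` family of
Riemannian metrics on a closed connected manifold modelled on `ℝᵐ`, `a < s < σ < t < T` and
every `x`,

  `𝒩*_s(x, t) ≤ ∫ 𝒩*_s(z, σ) dν_{x,t;σ}(z)`,

where `𝒩*_s(z, σ) = pointedNashEntropy h (K(z,σ;·,·)) m σ s` is the pointed Nash entropy of the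
conjugate heat kernel based at `(z, σ)` evaluated at time `s` and `ν_{x,t;σ}` is the conjugate
heat kernel measure. Proof: `σ' ↦ ∫ 𝒩*_s(·, σ') dν_{x,t;σ'}` is non-increasing on `[σ, t)`
(`integral_kernelNashEntropy_heatKernelMeasure_anti`) and tends to `𝒩*_s(x, t)` as `σ' → t⁻`
(`ν_{x,t;t} = δ_x`; continuity of `(z, σ') ↦ 𝒩*_s(z, σ')` and
`continuous_integral_slice_heatKernelMeasure`). [cite: Bamler2020Entropy, §5.4, (5.15)] -/
theorem kernelNashEntropy_le_integral_kernelNashEntropy_heatKernelMeasure {s σ t : ℝ}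
    (has : a < s) (hsσ : s < σ) (hσt : σ < t) (htT : t < T) (x : M) :
    pointedNashEntropy h (fun r y ↦ hflow.heatKernelFn hh hR t x (y, r)) m t s ≤
      ∫ z, pointedNashEntropy h (fun r y ↦ hflow.heatKernelFn hh hR σ z (y, r)) m σ s
        ∂(heatKernelMeasure hh hR t x σ) := by
  have hsT : s ∈ Ioo a T := ⟨has, (hsσ.trans hσt).trans htT⟩
  have hsub : Icc σ t ⊆ Ioc s T := fun r hr ↦ ⟨hsσ.trans_le hr.1, hr.2.trans htT.le⟩
  haveI : IsFiniteMeasure (h s).riemVolume := ⟨(h s).riemVolume_univ_lt_top⟩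
  -- (A) monotonicity on `(σ, t)`
  have hA : ∀ σ' ∈ Ioo σ t,
      ∫ z, pointedNashEntropy h (fun r y ↦ hflow.heatKernelFn hh hR σ' z (y, r)) m σ' s
          ∂(heatKernelMeasure hh hR t x σ') ≤
        ∫ z, pointedNashEntropy h (fun r y ↦ hflow.heatKernelFn hh hR σ z (y, r)) m σ s
          ∂(heatKernelMeasure hh hR t x σ) := fun σ' hσ' ↦
    integral_kernelNashEntropy_heatKernelMeasure_anti hflow hh hR has hsσ hσ'.1 hσ'.2 htT.le x
  -- (B) the continuous extension `Φ (z, σ') = 𝒩*_s(z, clamp σ')` of the entropy to `M × ℝ`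
  let cl : ℝ → ℝ := fun σ' ↦ max σ (min σ' t)
  have hclmem : ∀ σ', cl σ' ∈ Icc σ t := fun σ' ↦
    ⟨le_max_left _ _, max_le hσt.le (min_le_right _ _)⟩
  have hcleq : ∀ σ' ∈ Icc σ t, cl σ' = σ' := fun σ' hσ' ↦ by
    show max σ (min σ' t) = σ'
    rw [min_eq_left hσ'.2, max_eq_right hσ'.1]
  have hclc : Continuous cl := continuous_const.max (continuous_id.min continuous_const)
  let c : ℝ → ℝ := fun σ' ↦ (m : ℝ) / 2 * Real.log (4 * Real.pi * (σ' - s)) + (m : ℝ) / 2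
  have hc : c = fun σ' ↦ (m : ℝ) / 2 * Real.log (4 * Real.pi * (σ' - s)) + (m : ℝ) / 2 := rfl
  let Φ : M × ℝ → ℝ := fun p ↦
    ∫ y, Real.negMulLog (hflow.heatKernelFn hh hR (cl p.2) p.1 (y, s)) ∂(h s).riemVolume -
      c (cl p.2)
  have hΦ : Φ = fun p ↦
      ∫ y, Real.negMulLog (hflow.heatKernelFn hh hR (cl p.2) p.1 (y, s)) ∂(h s).riemVolume -
        c (cl p.2) := rfl
  have hΦeq : ∀ σ' ∈ Icc σ t, ∀ z,
      Φ (z, σ') = pointedNashEntropy h (fun r y ↦ hflow.heatKernelFn hh hR σ' z (y, r)) m σ' s := by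
    intro σ' hσ' z
    rw [hflow.kernelNashEntropy_eq_integral_negMulLog_sub hh hR
      ⟨(has.trans hsσ).trans_le hσ'.1, hσ'.2.trans htT.le⟩ z ⟨has, hsσ.trans_le hσ'.1⟩]
    simp only [hΦ, hc, hcleq σ' hσ']
  have hΦc : Continuous Φ := by
    have hKc : Continuous fun q : (M × ℝ) × M ↦
        hflow.heatKernelFn hh hR (cl q.1.2) q.1.1 (q.2, s) := by
      have hι : Continuous fun q : (M × ℝ) × M ↦ (((q.1.1, cl q.1.2) : M × ℝ), q.2) :=
        ((continuous_fst.comp continuous_fst).prodMk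
          (hclc.comp (continuous_snd.comp continuous_fst))).prodMk continuous_snd
      exact (hflow.continuousOn_heatKernelFn_basePoint hh hR hsT).comp_continuous hι
        fun q ↦ ⟨⟨mem_univ _, hsub (hclmem _)⟩, mem_univ _⟩
    have hF : Continuous fun p : M × ℝ ↦
        ∫ y, Real.negMulLog (hflow.heatKernelFn hh hR (cl p.2) p.1 (y, s)) ∂(h s).riemVolume := by
      have h1 := continuous_parametric_integral_of_continuous (μ := (h s).riemVolume)
        (f := fun (p : M × ℝ) y ↦ Real.negMulLog (hflow.heatKernelFn hh hR (cl p.2) p.1 (y, s)))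
        (Real.continuous_negMulLog.comp hKc) isCompact_univ
      simpa only [Measure.restrict_univ] using h1
    have hcc : Continuous fun p : M × ℝ ↦ c (cl p.2) := by
      have hpos : ∀ p : M × ℝ, 4 * Real.pi * (cl p.2 - s) ≠ 0 := fun p ↦
        (mul_pos (by positivity) (sub_pos.2 (hsσ.trans_le (hclmem p.2).1))).ne'
      show Continuous fun p : M × ℝ ↦
        (m : ℝ) / 2 * Real.log (4 * Real.pi * (cl p.2 - s)) + (m : ℝ) / 2
      exact (continuous_const.mul ((continuous_const.mul
        ((hclc.comp continuous_snd).sub continuous_const)).log hpos)).add continuous_const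
    exact hF.sub hcc
  -- (C) the limit `σ' → t⁻`
  have hG : Continuous fun σ' ↦ ∫ z, Φ (z, σ') ∂(heatKernelMeasure hh hR t x σ') :=
    continuous_integral_slice_heatKernelMeasure hh hR hΦc t x
  have hlim : Tendsto (fun σ' ↦ ∫ z, Φ (z, σ') ∂(heatKernelMeasure hh hR t x σ')) (𝓝[<] t)
      (𝓝 (∫ z, Φ (z, t) ∂(heatKernelMeasure hh hR t x t))) :=
    (hG.tendsto t).mono_left nhdsWithin_le_nhds
  have hev : ∀ᶠ σ' in 𝓝[<] t, ∫ z, Φ (z, σ') ∂(heatKernelMeasure hh hR t x σ') ≤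
      ∫ z, pointedNashEntropy h (fun r y ↦ hflow.heatKernelFn hh hR σ z (y, r)) m σ s
        ∂(heatKernelMeasure hh hR t x σ) := by
    filter_upwards [Ioo_mem_nhdsLT hσt] with σ' hσ'
    rw [integral_congr_ae (Eventually.of_forall fun z ↦ hΦeq σ' (Ioo_subset_Icc_self hσ') z)]
    exact hA σ' hσ'
  have hle := le_of_tendsto hlim hev
  rwa [heatKernelMeasure_self, integral_dirac, hΦeq t ⟨hσt.le, le_rfl⟩ x] at hle

end SelfModel

end Literature.Geometry.Riemannian

end
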